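import Mathlib
import Summits.ResolutionOfSingularities.ResolutionOfSingularities.Theorems.WeightedInvariantLocalWeightedDropWildMonicShift

/-!
# `WeightedInvariant.LocalWeightedDrop`, line `hasse-ridge-face-selection`: the TAYLOR SHIFT of a monic tuple in COEFFICIENTS
# (`shift d A φ j = Σ_n C(n+j, j) Â_{n+j} φ^n`)

Crux item stmt-ResolutionOfSingularities-8899 `LocalWeightedDrop` (route `ResolutionOfSingularities/WeightedInvariant`), engine of
the door `HypersurfaceCentreConstruction` stmt-ResolutionOfSingularities-19897.  [OURS · L1 W4.3, chain w43, res-type-083 (extra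
seat S3ρ, CHAIN v4.3 D12): sequel to `…WildMonicShift` (p497457) asked for by the S3ρD seats (res-D-pv-005 AS stub-7's ROADMAP
item (C2): Perlega 2017/2020 Lemma 5.1.1 / Prop 5.1.3 for tuples need the explicit shift formula).  Not a statement of any
manuscript.]

* `shift_eq_sum`: `shift d A φ j = Σ_{n < d - j + 1} C(n + j, j) · [Y^{n+j}](monicPoly d A) · φ^n`
  (`Polynomial.taylor_coeff`, `hasseDeriv_coeff`, `eval_eq_sum_range'`), where `[Y^i] monicPoly = A_i` (`i < d`), `1` (`i = d`);
* `shift_zero`: `shift d A 0 = A`;  `shift_zero_tuple`: the zero tuple shifts to the tuple of `(y + φ)^d`: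
  `shift d 0 φ j = C(d, j) · φ^{d-j}`.
-/

set_option linter.dupNamespace false -- mandated namespace of this single-conjunct summit

namespace Summit.ResolutionOfSingularities.ResolutionOfSingularities.Theorems

namespace WildMonic

variable {R : Type*} [CommRing R]

/-- THE TAYLOR SHIFT IN COEFFICIENTS: `shift d A φ j = Σ_{n=0}^{d-j} C(n+j, j) · [Y^{n+j}](monicPoly d A) · φ^n`. -/
theorem shift_eq_sum (d : ℕ) (A : Fin d → R) (φ : R) (j : Fin d) :
    shift d A φ j = ∑ n ∈ Finset.range (d - (j : ℕ) + 1),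
      (((n + (j : ℕ)).choose (j : ℕ) : ℕ) : R) * (monicPoly d A).coeff (n + (j : ℕ)) * φ ^ n := by
  have hlt : (Polynomial.hasseDeriv (j : ℕ) (monicPoly d A)).natDegree < d - (j : ℕ) + 1 :=
    lt_of_le_of_lt (Polynomial.natDegree_hasseDeriv_le _ _) (by
      have := natDegree_monicPoly_le d A
      have hj := j.2
      omega)
  rw [shift, Polynomial.taylor_coeff, Polynomial.eval_eq_sum_range' hlt]
  refine Finset.sum_congr rfl fun n _ => ?_
  rw [Polynomial.hasseDeriv_coeff]

/-- Shifting by `0` does nothing. -/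
theorem shift_zero [Nontrivial R] (d : ℕ) (A : Fin d → R) : shift d A 0 = A := by
  funext j
  rw [shift, Polynomial.taylor_zero, coeff_monicPoly_of_lt]

/-- THE ZERO TUPLE SHIFTS TO THE TUPLE OF `(y + φ)^d`: `shift d 0 φ j = C(d, j) φ^{d-j}`. -/
theorem shift_zero_tuple (d : ℕ) (φ : R) (j : Fin d) :
    shift d (fun _ : Fin d => (0 : R)) φ j = ((d.choose (j : ℕ) : ℕ) : R) * φ ^ (d - (j : ℕ)) := by
  classical
  rw [shift_eq_sum, Finset.sum_eq_single (d - (j : ℕ))]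
  · have hj := j.2
    rw [Nat.sub_add_cancel hj.le, coeff_monicPoly_self, mul_one]
  · intro n hn hne
    rw [coeff_monicPoly]
    have hnd : n + (j : ℕ) ≠ d := fun h => hne (by omega)
    rw [if_neg hnd, zero_add, Finset.sum_eq_zero (fun i _ => by split_ifs <;> rfl), mul_zero, zero_mul]
  · intro h
    exact absurd (Finset.mem_range.mpr (Nat.lt_succ_self _)) h

end WildMonic

end Summit.ResolutionOfSingularities.ResolutionOfSingularities.Theorems
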